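import Literature.Barriers.HubbardSuperconductivity.OrderParameterInvisibleToGroundStateConstraints
import HarnessLib

/-!
# Barrier: an energy-window relaxation cannot certify an order-parameter (or long-range-order) ceiling
# below the model's own sourced response at the window's slack (Wang et al. 2024 §II.D; Fawzi–Fawzi–Scalet 2024 §1)

Barrier catalogue `Literature/Barriers/HubbardSuperconductivity/` (D-0021), entry
`EnergyWindowCeilingResolution`, for the summit `HubbardSuperconductivity` and its venture
`CertifiedManyBodySolver` (certified two-sided windows on ground-state PAIRING observables obtained from
reduced-density-matrix / moment positivity plus a certified ENERGY WINDOW `Tr ρH ≤ E₀ + G`).  Companion of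
`OrderParameterInvisibleToGroundStateConstraints` (no FLOOR on a symmetry-odd order parameter from
ground-state-valid constraints); the present entry bounds what such relaxations can say as CEILINGS.

## What is vendored (as printed)

* J. Wang et al., *Certifying ground-state properties of many-body systems*, PRX **14** (2024) 031006
  (`WangEtAl2024`, held as `paper:arxiv-2310.05844`), §II.D p. 9, verbatim: "A direct application of the method
  would provide rather trivial bounds, because the optimisation is not restricted to a region close to the ground
  state. To enforce this, one can use the best upper bound `E↑` to the ground-state energy derived through
  variational methods … `⟨ψ|E↑ − H(X)|ψ⟩ ≥ 0` and `⟨ψ|H(X) − E↓|ψ⟩ ≥ 0` … can be added as additional constraints"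
  and "Note that in this case, the asymptotic value `o^(∞)` is only guaranteed to be equal to the actual
  ground-state value `o_GS` if `E↑ = E↓`."; p. 16, verbatim: "In the absence of spontaneous symmetry breaking,
  `m = 0`; while `m = m₀` signals the onset of long-range order in the thermodynamic limit. We expect that the
  latter case would manifest itself in the upper (lower) bound saturating to `m₀` (`−m₀`) while increasing the
  level of the SDP hierarchy."
* H. Fawzi, O. Fawzi, S. O. Scalet, *Certified algorithms for equilibrium states of local quantum
  Hamiltonians*, Nat. Commun. **15** (2024) 7394 (`FawziFawziScalet2024`, held as `paper:arxiv-2311.18706`),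
  §1 "Related work", verbatim: "Using such two-sided bounds on the ground energy, the recent works [wang2023,
  han2020] obtain bounds for expectation values of local observables in the ground state, although no
  convergence guarantees are given. The approach based on imposing the additional constraint (eq:gs)
  [the ground-state optimality condition], which leads to convergence guarantees, was proposed independently
  and concurrently in [navascuesKKT]" (`AraujoEtAl2023`).
* T. Koma, H. Tasaki, J. Stat. Phys. **76** (1994) 745 (`KomaTasaki1994`), §1: the order parameter is read in
  the ground states of the SOURCED Hamiltonian `H − s·O` (symmetry-breaking field `s`), whose one-point
  function `m(s)` is the model's response.

WHAT THIS ENTRY MAKES QUANTITATIVE (and proves, in the finite-dimensional setting of every finite-volume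
certificate).  Fix a Hamiltonian `H`, a unitary `U` commuting with `H`, an order operator `O` odd under `U`
(`U†OU = −O`: a pair field under the particle-number rotation by `π/2`, a staggered moment under the spin flip),
a ground-state density matrix `ρ₀` (energy `E₀ = Re Tr ρ₀H`) and a slack `G ≥ 0`.  The EXACT WINDOW SET
`W(G) = {ρ density matrix : Re Tr ρH ≤ E₀ + G}` — contained in the feasible set of EVERY sound energy-window
relaxation, whatever its word set, level, footprint or solver — already contains, for every density matrix `σ`
(energy excess `D = Re Tr σH − E₀ ≥ 0`, order `m = Re Tr σO`), the mixture `(1 − η)·ρ̄₀ + η·σ` of the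
symmetrised ground state `ρ̄₀ = ½(ρ₀ + Uρ₀U†)` (order `0`, energy `E₀`) with `σ`, for every `η ∈ [0,1]` with
`ηD ≤ G`; its order is `η·m` and its `A†A`-expectation is `≥ η·(Re Tr σA)²` (`exists_isDensityMatrix_window`).
Consequently (`EnergyWindowCeilingResolution_holds`):
* (1) every ceiling `c` with `Re Tr ρO ≤ c` on `W(G)` obeys `min(m, (G/D)·m) ≤ c` for EVERY state `σ`
  (`window_ceiling_ge`) — "a ceiling can never be pushed below the order carried by a low-energy state,
  diluted linearly in `G/D`";
* (2) SOURCED FORM: if `σ` is a ground-state density matrix of `H − s·O` (`s > 0`) then `D ≤ s·m`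
  (`energyExcess_le_of_sourced`), hence `min(m(s), G/s) ≤ c` (`window_ceiling_ge_sourced`): no energy-window
  relaxation certifies an order-parameter ceiling below the model's OWN sourced response at the field
  `s = G/m(s)` — for a linear response `m = χs` this floor is `√(χG)`, the secant (3) is `√(2χG)`;
* (2′) TWO-POINT FORM: every ceiling `ℓ` with `Re Tr ρ(A†A) ≤ ℓ` on `W(G)` obeys
  `min(a², G·a²/(s·m(s))) ≤ ℓ`, `a = Re Tr σA`, for the same sourced `σ` and EVERY `A`
  (`window_lro_ceiling_ge_sourced`; `A = O`: `min(m², G·m/s) ≤ ℓ`, `window_lro_ceiling_ge_sourced_self`) —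
  the long-range-order / structure-factor version;
* (3) conversely (weak duality, the tree's "λ-form"): every `ρ ∈ W(G)` has `Re Tr ρO ≤ (E₀ + G − f)/s` for any
  lower bound `f` on the sourced energy `Re Tr ρ(H − sO)` over density matrices (`window_ceiling_le_secant`), so
  the exact window value is bracketed by the sourced energy curve on both sides;
* (4) the LOWER energy row `E↓ ≤ Re Tr ρH` with `E↓ ≤ E₀` is satisfied by EVERY density matrix
  (`lowerRow_of_isDensityMatrix`): it never removes a state, only pseudo-states — the structural form of the
  cell's measured "κ_ge idle" (TARGET §8 P2′);
* (5) the EVASION is typed: a row NOT satisfied by every low-energy state — stationarity `Tr ρ[H,X] = 0`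
  (equation-of-motion rows, [cite: FawziFawziScalet2024, §1] / `AraujoEtAl2023`) or ground-state positivity —
  removes the mixture as soon as `Tr σ[H,X] ≠ 0` (`trace_mixture_mul_ne_zero`); the sourced ground states of
  (2) are exactly such non-stationary states (`Tr σ_s[H,X] = s·Tr σ_s[O,X]`);
* (6) (§Cells, appended 2026-08-27) INTERVAL rows `|Re Tr ρ[M,X_i]| ≤ b_i` (the μ-cell / slack-row form of
  stationarity, hubbard-obs tier OP1-C) only DILUTE the obstruction: `min(η̄·m, (G/D)·m) ≤ c` with
  `η̄ = min_i b_i/|Re Tr σ[M,X_i]| ∧ 1` (`window_ceiling_ge_of_intervalRows`), and for sourced `σ_s`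
  `min(η̄·m(s), G/s) ≤ c` with `η̄ = min_i b_i/(s·|Re Tr σ_s[O,X_i]|) ∧ 1` (`window_ceiling_ge_sourced_of_intervalRows`)
  — linear in the slack, i.e. in the cell width.

Reading for the cell (hubbard-obs BURST-INPUTS §3 "model-independent form", EPS-ELASTICITY §5 (b2), PAIRCORR-SDP
§15.4 — there labelled [est]/[float]/"structural remark, not typed"): with `G = hi − e₀` the certified cap's slack
above the TRUE ground-state energy density, the one-point pair ceiling `M` of any OP1-E-class object and the
pair-LRO / `F_B` ceilings of any box object are floored by the printed sourced d-wave response `m(h)` through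
(2)/(2′); the float input is `m(h)` alone, the law is this file.  Numbers are the cell's, not this file's.

## Lean rendering

Finite dimension; `IsDensityMatrix`, `IsGroundStateDensityMatrix`, `symmetrise` are those of
`OrderParameterInvisibleToGroundStateConstraints.lean` (Nielsen–Chuang Thm 2.5; Scheer et al. 2025 p. 3).  The only
new definition is the two-state `mixture η ρ σ = (1 − η)ρ + ησ`.  Energies and orders are `Re Tr(ρ·X)`; no
Hermiticity of `H` or `O` is needed for the algebra, and the ground energy enters only as `Re Tr ρ₀H` of the
given ground-state density matrix (all ground-state density matrices have the same energy by definition), so no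
spectral theory is used.  Everything is PROVED; no named fact is introduced.

The catalogue block (technique_class / blocks / because / evasions_known / scope_caveats / status) is on the
declaration `EnergyWindowCeilingResolution` below.

## References
* [WangEtAl2024] J. Wang, J. Surace, I. Frérot, B. Legat, M.-O. Renou, V. Magron, A. Acín, PRX 14 (2024) 031006,
  arXiv:2310.05844, §II.D (p. 9), §V outlook (p. 16).
* [FawziFawziScalet2024] H. Fawzi, O. Fawzi, S. O. Scalet, Nat. Commun. 15 (2024) 7394, arXiv:2311.18706, §1.
* [AraujoEtAl2023] M. Araújo, I. Klep, A. J. P. Garner, T. Vértesi, M. Navascués, arXiv:2311.18707.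
* [KomaTasaki1994] T. Koma, H. Tasaki, J. Stat. Phys. 76 (1994) 745–803, §1.
* [NielsenChuang2010] M. A. Nielsen, I. L. Chuang, CUP 2010, Thm 2.5 (density operators, §2.4.2).
* [BratteliRobinsonI1987] O. Bratteli, D. W. Robinson, *Operator Algebras and Quantum Statistical Mechanics 1*,
  2nd ed., Springer 1987, Lemma 2.3.10 (positivity and the Cauchy–Schwarz inequality for states).
* Cell memos (not sources of mathematics): `run/shared/lean/pub/hubbard-obs/BURST-INPUTS-obs.md` §3,
  `…/hubbard-obs-gs/EPS-ELASTICITY.md` §5, `…/obs-p1/PAIRCORR-SDP.md` §15.4.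
-/

namespace Literature.Barriers.HubbardSuperconductivity

open Matrix
open scoped ComplexOrder

section Mixture

variable {n : Type*} [Fintype n]

/-- The two-state mixture `(1 − η)·ρ + η·σ` (a convex combination of density matrices for `η ∈ [0,1]`).
[cite: NielsenChuang2010, Thm 2.5 (§2.4.2)] -/
def mixture (η : ℝ) (ρ σ : Matrix n n ℂ) : Matrix n n ℂ :=
  ((1 - η : ℝ) : ℂ) • ρ + ((η : ℝ) : ℂ) • σ

/-- Expectations in the mixture are the mixed expectations: `Tr(((1−η)ρ + ησ)X) = (1−η)Tr(ρX) + ηTr(σX)`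
(linearity of the trace in the density operator of an ensemble). [cite: NielsenChuang2010, Thm 2.5 (§2.4.2)] -/
theorem trace_mixture_mul (η : ℝ) (ρ σ X : Matrix n n ℂ) :
    (mixture η ρ σ * X).trace = ((1 - η : ℝ) : ℂ) * (ρ * X).trace + ((η : ℝ) : ℂ) * (σ * X).trace := by
  unfold mixture
  rw [Matrix.add_mul, Matrix.smul_mul, Matrix.smul_mul, Matrix.trace_add, Matrix.trace_smul,
    Matrix.trace_smul, smul_eq_mul, smul_eq_mul]

/-- Real parts of expectations in the mixture: `Re Tr(ρ_η X) = (1−η)·Re Tr(ρX) + η·Re Tr(σX)`.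
[cite: NielsenChuang2010, Thm 2.5 (§2.4.2)] -/
theorem re_trace_mixture_mul (η : ℝ) (ρ σ X : Matrix n n ℂ) :
    (mixture η ρ σ * X).trace.re = (1 - η) * (ρ * X).trace.re + η * (σ * X).trace.re := by
  rw [trace_mixture_mul, Complex.add_re, Complex.re_ofReal_mul, Complex.re_ofReal_mul]

/-- A convex combination of density matrices is a density matrix. [cite: NielsenChuang2010, Thm 2.5 (§2.4.2)] -/
theorem isDensityMatrix_mixture {η : ℝ} (hη0 : 0 ≤ η) (hη1 : η ≤ 1) {ρ σ : Matrix n n ℂ}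
    (hρ : IsDensityMatrix ρ) (hσ : IsDensityMatrix σ) : IsDensityMatrix (mixture η ρ σ) := by
  refine ⟨?_, ?_⟩
  · have h1 : (0 : ℂ) ≤ ((1 - η : ℝ) : ℂ) := Complex.zero_le_real.mpr (by linarith)
    have h2 : (0 : ℂ) ≤ ((η : ℝ) : ℂ) := Complex.zero_le_real.mpr hη0
    exact (hρ.1.smul h1).add (hσ.1.smul h2)
  · unfold mixture
    rw [Matrix.trace_add, Matrix.trace_smul, Matrix.trace_smul, hρ.2, hσ.2, smul_eq_mul, smul_eq_mul]
    push_cast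
    ring

/-- The evasion mechanism, typed: a LINEAR row `Tr(ρX) = 0` that the first component passes and the second
violates is violated by every proper mixture — this is how a stationarity (equation-of-motion) row
`Tr(ρ[H,X]) = 0` removes the mixtures of this file while no energy-window row does.
[cite: FawziFawziScalet2024, §1] -/
theorem trace_mixture_mul_ne_zero {η : ℝ} (hη : η ≠ 0) {ρ σ X : Matrix n n ℂ} (hρ : (ρ * X).trace = 0)
    (hσ : (σ * X).trace ≠ 0) : (mixture η ρ σ * X).trace ≠ 0 := by
  rw [trace_mixture_mul, hρ, mul_zero, zero_add]
  exact mul_ne_zero (Complex.ofReal_ne_zero.mpr hη) hσ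

/-- Positivity of a state on `A†A`: `0 ≤ Re Tr σ(A†A)` for a positive semidefinite `σ` (a density matrix defines a
positive linear functional). [cite: BratteliRobinsonI1987, Lemma 2.3.10 (§2.3.2)] -/
theorem re_trace_mul_conjTranspose_mul_self_nonneg {σ : Matrix n n ℂ} (hσ : σ.PosSemidef)
    (A : Matrix n n ℂ) : 0 ≤ (σ * (Aᴴ * A)).trace.re := by
  have h := (hσ.mul_mul_conjTranspose_same A).trace_nonneg
  rw [Matrix.trace_mul_cycle, Matrix.trace_mul_comm] at h
  have h' := (Complex.le_def.1 h).1
  rwa [Complex.zero_re] at h'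

/-- Cauchy–Schwarz for a state: `(Re Tr σA)² ≤ |Tr σA|² ≤ Tr σ(A†A)` for every density matrix `σ` and every `A`
(Bratteli–Robinson's `|ω(A*B)|² ≤ ω(A*A)ω(B*B)` with `B = 1`; proved from `0 ≤ Tr σ (A − a)†(A − a)`,
`a = Tr σA`). [cite: BratteliRobinsonI1987, Lemma 2.3.10 (§2.3.2)] -/
theorem sq_re_trace_mul_le {σ : Matrix n n ℂ} (hσ : IsDensityMatrix σ) (A : Matrix n n ℂ) :
    (σ * A).trace.re ^ 2 ≤ (σ * (Aᴴ * A)).trace.re := by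
  classical
  -- the shifted operator `B = A − a·1`, `a = Tr σA`
  set a : ℂ := (σ * A).trace with ha
  set B : Matrix n n ℂ := A - a • (1 : Matrix n n ℂ) with hB
  -- positivity of the state on `B†B`
  have hpos : 0 ≤ (σ * (Bᴴ * B)).trace := by
    have h := (hσ.1.mul_mul_conjTranspose_same B).trace_nonneg
    rwa [Matrix.trace_mul_cycle, Matrix.trace_mul_comm] at h
  -- `Tr σA† = conj (Tr σA)` for Hermitian `σ`
  have hconj : (σ * Aᴴ).trace = star a := by
    rw [ha, ← Matrix.trace_conjTranspose, Matrix.conjTranspose_mul, hσ.1.1.eq, Matrix.trace_mul_comm]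
  -- expand `Tr σ B†B = Tr σA†A − a·ā`
  have hexp : (σ * (Bᴴ * B)).trace = (σ * (Aᴴ * A)).trace - a * star a := by
    simp only [hB, Matrix.conjTranspose_sub, Matrix.conjTranspose_smul, Matrix.conjTranspose_one,
      Matrix.sub_mul, Matrix.mul_sub, Matrix.smul_mul, Matrix.mul_smul, Matrix.one_mul, Matrix.mul_one,
      Matrix.trace_sub, Matrix.trace_smul, smul_eq_mul, hconj, hσ.2]
    rw [← ha]
    ring
  rw [hexp] at hpos
  -- take real parts: `a.re² ≤ |a|² ≤ Re Tr σA†A`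
  have hre := (Complex.le_def.1 hpos).1
  rw [Complex.zero_re, Complex.sub_re, Complex.star_def, Complex.mul_conj, Complex.ofReal_re] at hre
  have hns : a.re ^ 2 ≤ Complex.normSq a := by
    rw [Complex.normSq_apply]; nlinarith [sq_nonneg a.im]
  linarith

end Mixture

section Window

variable {n : Type*} [Fintype n] [DecidableEq n]

omit [DecidableEq n] in
/-- Every density matrix has energy `≥ E₀ = Re Tr ρ₀H` (all ground-state density matrices share this energy):
the LOWER window row `E↓ ≤ Re Tr ρH` with `E↓ ≤ E₀` holds for EVERY density matrix — it never removes a state,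
only pseudo-states (structural form of "the `ge` row is idle for states"). [cite: WangEtAl2024, §II.D p. 9] -/
theorem lowerRow_of_isDensityMatrix {H ρ₀ : Matrix n n ℂ} (hρ₀ : IsGroundStateDensityMatrix H ρ₀) {lo : ℝ}
    (hlo : lo ≤ (ρ₀ * H).trace.re) {ρ : Matrix n n ℂ} (hρ : IsDensityMatrix ρ) : lo ≤ (ρ * H).trace.re :=
  hlo.trans (hρ₀.2 ρ hρ)

/-- **The window state.** For a ground-state density matrix `ρ₀` of `H` (energy `E₀ = Re Tr ρ₀H`), a unitary
`U` commuting with `H`, an order operator `O` odd under `U`, ANY density matrix `σ` and any `η ∈ [0,1]` with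
`η·(Re Tr σH − E₀) ≤ G`, the mixture `ρ = (1−η)ρ̄₀ + ησ` of the symmetrised ground state with `σ` is a density
matrix INSIDE the window `Re Tr ρH ≤ E₀ + G`, with order exactly `η·Re Tr σO` and, for every `A`,
`Re Tr ρ(A†A) ≥ η·(Re Tr σA)²`. [cite: WangEtAl2024, §II.D p. 9] [cite: KomaTasaki1994, §1] -/
theorem exists_isDensityMatrix_window {H U O ρ₀ σ : Matrix n n ℂ} (hU : Uᴴ * U = 1) (hHU : H * U = U * H)
    (hOU : Uᴴ * O * U = -O) (hρ₀ : IsGroundStateDensityMatrix H ρ₀) (hσ : IsDensityMatrix σ) {η G : ℝ}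
    (hη0 : 0 ≤ η) (hη1 : η ≤ 1) (hηG : η * ((σ * H).trace.re - (ρ₀ * H).trace.re) ≤ G) (A : Matrix n n ℂ) :
    ∃ ρ : Matrix n n ℂ, IsDensityMatrix ρ ∧ (ρ * H).trace.re ≤ (ρ₀ * H).trace.re + G ∧
      (ρ * O).trace.re = η * (σ * O).trace.re ∧ η * (σ * A).trace.re ^ 2 ≤ (ρ * (Aᴴ * A)).trace.re := by
  have hρs := isGroundStateDensityMatrix_symmetrise hU hHU hρ₀
  refine ⟨mixture η (symmetrise U ρ₀) σ, isDensityMatrix_mixture hη0 hη1 hρs.1 hσ, ?_, ?_, ?_⟩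
  · rw [re_trace_mixture_mul, trace_symmetrise_mul_eq hU hHU]
    linarith
  · rw [re_trace_mixture_mul, trace_symmetrise_mul_eq_zero hOU, Complex.zero_re, mul_zero, zero_add]
  · rw [re_trace_mixture_mul]
    have h0 := re_trace_mul_conjTranspose_mul_self_nonneg hρs.1.1 A
    have h1 : 0 ≤ 1 - η := by linarith
    have h2 := mul_le_mul_of_nonneg_left (sq_re_trace_mul_le hσ A) hη0
    nlinarith [mul_nonneg h1 h0, h2]

/-- **Clause (1): every low-energy state floors the ceiling, diluted linearly in `G/D`.**  If `c` is a ceiling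
on the order `Re Tr ρO` valid for every density matrix in the window `Re Tr ρH ≤ E₀ + G` (`G ≥ 0`), then for
EVERY density matrix `σ` with energy excess `D = Re Tr σH − E₀` and order `m = Re Tr σO`:
`min(m, (G/D)·m) ≤ c`. [cite: WangEtAl2024, §II.D p. 9 and p. 16] -/
theorem window_ceiling_ge {H U O ρ₀ σ : Matrix n n ℂ} (hU : Uᴴ * U = 1) (hHU : H * U = U * H)
    (hOU : Uᴴ * O * U = -O) (hρ₀ : IsGroundStateDensityMatrix H ρ₀) (hσ : IsDensityMatrix σ) {G c : ℝ}
    (hG : 0 ≤ G)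
    (hc : ∀ ρ : Matrix n n ℂ, IsDensityMatrix ρ → (ρ * H).trace.re ≤ (ρ₀ * H).trace.re + G →
      (ρ * O).trace.re ≤ c) :
    min ((σ * O).trace.re) (G / ((σ * H).trace.re - (ρ₀ * H).trace.re) * (σ * O).trace.re) ≤ c := by
  set D : ℝ := (σ * H).trace.re - (ρ₀ * H).trace.re with hD
  set m : ℝ := (σ * O).trace.re with hm
  have hD0 : 0 ≤ D := by have := hρ₀.2 σ hσ; linarith
  by_cases hDG : D ≤ G
  · -- `σ` itself lies in the window (`η = 1`)
    obtain ⟨ρ, hρ, hρH, hρO, -⟩ :=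
      exists_isDensityMatrix_window hU hHU hOU hρ₀ hσ zero_le_one le_rfl (by linarith : (1 : ℝ) * D ≤ G) O
    have h := hc ρ hρ hρH
    rw [hρO, one_mul] at h
    exact (min_le_left _ _).trans h
  · -- dilute: `η = G/D`
    have hDG' : G < D := lt_of_not_ge hDG
    have hDpos : 0 < D := lt_of_le_of_lt hG hDG'
    have hη1 : G / D ≤ 1 := (div_le_one hDpos).mpr hDG'.le
    have hηG : G / D * D ≤ G := (div_mul_cancel₀ G hDpos.ne').le
    obtain ⟨ρ, hρ, hρH, hρO, -⟩ :=
      exists_isDensityMatrix_window hU hHU hOU hρ₀ hσ (div_nonneg hG hD0) hη1 hηG O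
    have h := hc ρ hρ hρH
    rw [hρO] at h
    exact (min_le_right _ _).trans h

/-- **Sourced states pay at most `s·m` in energy.**  If `σ` is a ground-state density matrix of the SOURCED
Hamiltonian `H − s·O` and `O` is odd under a unitary symmetry `U` of `H`, then its energy excess over the
ground energy of `H` is at most the source times its order: `Re Tr σH − E₀ ≤ s·Re Tr σO`
(variational comparison with the symmetrised ground state, whose order vanishes). [cite: KomaTasaki1994, §1] -/
theorem energyExcess_le_of_sourced {H U O ρ₀ σ : Matrix n n ℂ} (hU : Uᴴ * U = 1) (hHU : H * U = U * H)
    (hOU : Uᴴ * O * U = -O) (hρ₀ : IsGroundStateDensityMatrix H ρ₀) {s : ℝ}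
    (hσ : IsGroundStateDensityMatrix (H - (s : ℂ) • O) σ) :
    (σ * H).trace.re - (ρ₀ * H).trace.re ≤ s * (σ * O).trace.re := by
  have hρs := isGroundStateDensityMatrix_symmetrise hU hHU hρ₀
  have h := hσ.2 (symmetrise U ρ₀) hρs.1
  rw [Matrix.mul_sub, Matrix.mul_sub, Matrix.mul_smul, Matrix.mul_smul, Matrix.trace_sub, Matrix.trace_sub,
    Matrix.trace_smul, Matrix.trace_smul, trace_symmetrise_mul_eq hU hHU, trace_symmetrise_mul_eq_zero hOU,
    smul_eq_mul, smul_eq_mul, mul_zero, sub_zero, Complex.sub_re, Complex.re_ofReal_mul] at h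
  linarith

/-- **Clause (2): the sourced-response floor.**  If `c` is a ceiling on `Re Tr ρO` over the window
`Re Tr ρH ≤ E₀ + G` (`G ≥ 0`) and `σ` is a ground-state density matrix of `H − s·O`, `s > 0`, with response
`m(s) = Re Tr σO`, then `min(m(s), G/s) ≤ c`: no energy-window relaxation certifies an order-parameter
ceiling below the model's own sourced response at the field `s = G/m(s)`.
[cite: WangEtAl2024, §II.D p. 9 and p. 16] [cite: KomaTasaki1994, §1] -/
theorem window_ceiling_ge_sourced {H U O ρ₀ σ : Matrix n n ℂ} (hU : Uᴴ * U = 1) (hHU : H * U = U * H)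
    (hOU : Uᴴ * O * U = -O) (hρ₀ : IsGroundStateDensityMatrix H ρ₀) {s G c : ℝ} (hs : 0 < s)
    (hσ : IsGroundStateDensityMatrix (H - (s : ℂ) • O) σ) (hG : 0 ≤ G)
    (hc : ∀ ρ : Matrix n n ℂ, IsDensityMatrix ρ → (ρ * H).trace.re ≤ (ρ₀ * H).trace.re + G →
      (ρ * O).trace.re ≤ c) :
    min ((σ * O).trace.re) (G / s) ≤ c := by
  set D : ℝ := (σ * H).trace.re - (ρ₀ * H).trace.re with hD
  set m : ℝ := (σ * O).trace.re with hm
  have hDm : D ≤ s * m := energyExcess_le_of_sourced hU hHU hOU hρ₀ hσ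
  have hmain : min m (G / D * m) ≤ c := window_ceiling_ge hU hHU hOU hρ₀ hσ.1 hG hc
  by_cases hDG : D ≤ G
  · obtain ⟨ρ, hρ, hρH, hρO, -⟩ :=
      exists_isDensityMatrix_window hU hHU hOU hρ₀ hσ.1 zero_le_one le_rfl (by linarith : (1 : ℝ) * D ≤ G) O
    have h := hc ρ hρ hρH
    rw [hρO, one_mul] at h
    exact (min_le_left _ _).trans h
  · have hDG' : G < D := lt_of_not_ge hDG
    have hDpos : 0 < D := lt_of_le_of_lt hG hDG'
    have hmpos : 0 < m := by nlinarith
    have hη1 : G / D ≤ 1 := (div_le_one hDpos).mpr hDG'.le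
    -- `G/s ≤ (G/D)·m` because `D ≤ s·m`, and `(G/D)·m ≤ m`
    have hcmp : G / s ≤ G / D * m := by
      rw [div_mul_eq_mul_div, div_le_div_iff₀ hs hDpos]
      nlinarith
    have hmin : min m (G / D * m) = G / D * m :=
      min_eq_right (by nlinarith [mul_le_mul_of_nonneg_right hη1 hmpos.le])
    rw [hmin] at hmain
    exact (min_le_right _ _).trans (hcmp.trans hmain)

/-- **Clause (2′): the two-point (long-range-order) floor.**  If `ℓ` is a ceiling on `Re Tr ρ(A†A)` over the
window `Re Tr ρH ≤ E₀ + G` (`G ≥ 0`), `σ` is a ground-state density matrix of `H − s·S` (`s > 0`, `S` odd under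
the symmetry `U` of `H`) with response `m = Re Tr σS`, and `a = Re Tr σA` for an arbitrary `A`, then
`min(a², G·a²/(s·m)) ≤ ℓ`. [cite: WangEtAl2024, §II.D p. 9 and p. 16] [cite: KomaTasaki1994, §1] -/
theorem window_lro_ceiling_ge_sourced {H U S ρ₀ σ : Matrix n n ℂ} (hU : Uᴴ * U = 1) (hHU : H * U = U * H)
    (hSU : Uᴴ * S * U = -S) (hρ₀ : IsGroundStateDensityMatrix H ρ₀) {s G ℓ : ℝ} (hs : 0 < s)
    (hσ : IsGroundStateDensityMatrix (H - (s : ℂ) • S) σ) (hG : 0 ≤ G) (A : Matrix n n ℂ)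
    (hℓ : ∀ ρ : Matrix n n ℂ, IsDensityMatrix ρ → (ρ * H).trace.re ≤ (ρ₀ * H).trace.re + G →
      (ρ * (Aᴴ * A)).trace.re ≤ ℓ) :
    min ((σ * A).trace.re ^ 2) (G * (σ * A).trace.re ^ 2 / (s * (σ * S).trace.re)) ≤ ℓ := by
  set D : ℝ := (σ * H).trace.re - (ρ₀ * H).trace.re with hD
  set m : ℝ := (σ * S).trace.re with hm
  set a : ℝ := (σ * A).trace.re with ha
  have hDm : D ≤ s * m := energyExcess_le_of_sourced hU hHU hSU hρ₀ hσ
  have hD0 : 0 ≤ D := by have := hρ₀.2 σ hσ.1; linarith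
  by_cases hDG : D ≤ G
  · obtain ⟨ρ, hρ, hρH, -, hρA⟩ :=
      exists_isDensityMatrix_window hU hHU hSU hρ₀ hσ.1 zero_le_one le_rfl (by linarith : (1 : ℝ) * D ≤ G) A
    have h := hℓ ρ hρ hρH
    rw [one_mul] at hρA
    exact (min_le_left _ _).trans (hρA.trans h)
  · have hDG' : G < D := lt_of_not_ge hDG
    have hDpos : 0 < D := lt_of_le_of_lt hG hDG'
    have hmpos : 0 < m := by nlinarith
    have hη1 : G / D ≤ 1 := (div_le_one hDpos).mpr hDG'.le
    have hηG : G / D * D ≤ G := (div_mul_cancel₀ G hDpos.ne').le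
    obtain ⟨ρ, hρ, hρH, -, hρA⟩ :=
      exists_isDensityMatrix_window hU hHU hSU hρ₀ hσ.1 (div_nonneg hG hD0) hη1 hηG A
    have h := hℓ ρ hρ hρH
    -- `G a²/(s m) ≤ (G/D) a²` because `D ≤ s m`
    have ha2 : 0 ≤ G * a ^ 2 := mul_nonneg hG (sq_nonneg a)
    have hcmp : G * a ^ 2 / (s * m) ≤ G / D * a ^ 2 := by
      rw [div_mul_eq_mul_div, div_le_div_iff₀ (mul_pos hs hmpos) hDpos]
      exact mul_le_mul_of_nonneg_left hDm ha2
    exact (min_le_right _ _).trans (hcmp.trans (hρA.trans h))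

/-- Clause (2′) with `A = S = O`: `min(m², G·m/s) ≤ ℓ` for every two-point ceiling `ℓ` on `Re Tr ρ(O†O)` over
the window and every sourced ground state `σ` of `H − s·O` with response `m = Re Tr σO`.
[cite: WangEtAl2024, §II.D p. 9 and p. 16] [cite: KomaTasaki1994, §1] -/
theorem window_lro_ceiling_ge_sourced_self {H U O ρ₀ σ : Matrix n n ℂ} (hU : Uᴴ * U = 1)
    (hHU : H * U = U * H) (hOU : Uᴴ * O * U = -O) (hρ₀ : IsGroundStateDensityMatrix H ρ₀) {s G ℓ : ℝ}
    (hs : 0 < s) (hσ : IsGroundStateDensityMatrix (H - (s : ℂ) • O) σ) (hG : 0 ≤ G)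
    (hℓ : ∀ ρ : Matrix n n ℂ, IsDensityMatrix ρ → (ρ * H).trace.re ≤ (ρ₀ * H).trace.re + G →
      (ρ * (Oᴴ * O)).trace.re ≤ ℓ) :
    min ((σ * O).trace.re ^ 2) (G * (σ * O).trace.re / s) ≤ ℓ := by
  have h := window_lro_ceiling_ge_sourced hU hHU hOU hρ₀ hs hσ hG O hℓ
  set m : ℝ := (σ * O).trace.re with hm
  by_cases hm0 : m = 0
  · rw [hm0] at h ⊢
    simpa using h
  · have hre : G * m ^ 2 / (s * m) = G * m / s := by
      rw [pow_two, ← mul_assoc, mul_div_mul_right _ _ hm0]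
    rwa [hre] at h

omit [DecidableEq n] in
/-- **Clause (3): the secant ceiling (weak duality, the "λ-form").**  Every density matrix in the window
`Re Tr ρH ≤ E₀ + G` obeys `Re Tr ρO ≤ (E₀ + G − f)/s` for every `s > 0` and every lower bound `f` on the
sourced energy `Re Tr ρ(H − sO)` valid for all density matrices (e.g. the sourced ground energy).  Together
with clause (2) the exact window value is bracketed by the sourced energy curve on both sides.
[cite: WangEtAl2024, §II.D p. 9] -/
theorem window_ceiling_le_secant {H O ρ₀ ρ : Matrix n n ℂ} {s G f : ℝ} (hs : 0 < s)
    (hf : ∀ τ : Matrix n n ℂ, IsDensityMatrix τ → f ≤ (τ * (H - (s : ℂ) • O)).trace.re)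
    (hρ : IsDensityMatrix ρ) (hρH : (ρ * H).trace.re ≤ (ρ₀ * H).trace.re + G) :
    (ρ * O).trace.re ≤ ((ρ₀ * H).trace.re + G - f) / s := by
  have h := hf ρ hρ
  rw [Matrix.mul_sub, Matrix.mul_smul, Matrix.trace_sub, Matrix.trace_smul, smul_eq_mul, Complex.sub_re,
    Complex.re_ofReal_mul] at h
  rw [le_div_iff₀ hs]
  linarith

/-- **Any sound relaxation inherits the floor.**  If a feasibility predicate `Feasible` (the pseudo-states of a
moment / RDM / NPA relaxation, at any level) contains every density matrix of the window, then any certificate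
`Re Tr ρO ≤ c` on `Feasible` is a window ceiling, hence `≥ min(m(s), G/s)` for every sourced ground state.
[cite: WangEtAl2024, §II.D p. 9 and p. 16] [cite: FawziFawziScalet2024, §1] -/
theorem relaxation_ceiling_ge_sourced {H U O ρ₀ σ : Matrix n n ℂ} (hU : Uᴴ * U = 1) (hHU : H * U = U * H)
    (hOU : Uᴴ * O * U = -O) (hρ₀ : IsGroundStateDensityMatrix H ρ₀) {s G c : ℝ} (hs : 0 < s)
    (hσ : IsGroundStateDensityMatrix (H - (s : ℂ) • O) σ) (hG : 0 ≤ G) {Feasible : Matrix n n ℂ → Prop}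
    (hsound : ∀ ρ : Matrix n n ℂ, IsDensityMatrix ρ → (ρ * H).trace.re ≤ (ρ₀ * H).trace.re + G → Feasible ρ)
    (hcert : ∀ ρ : Matrix n n ℂ, Feasible ρ → (ρ * O).trace.re ≤ c) :
    min ((σ * O).trace.re) (G / s) ≤ c :=
  window_ceiling_ge_sourced hU hHU hOU hρ₀ hs hσ hG fun ρ hρ hρH => hcert ρ (hsound ρ hρ hρH)

end Window

/-- **BARRIER `EnergyWindowCeilingResolution` (Wang et al. 2024 §II.D; Fawzi–Fawzi–Scalet 2024 §1; Koma–Tasaki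
1994 §1).**  For every finite-dimensional `H`, every unitary `U` commuting with `H`, every `O` odd under `U`,
every ground-state density matrix `ρ₀` of `H` (energy `E₀ = Re Tr ρ₀H`) and every slack `G ≥ 0`:
(1) every ceiling `c` on the order `Re Tr ρO` valid over the exact window set `{ρ : Re Tr ρH ≤ E₀ + G}` obeys
`min(m, (G/D)·m) ≤ c` for EVERY density matrix `σ` (order `m`, energy excess `D`), and `min(m(s), G/s) ≤ c`
for every ground-state density matrix `σ` of the sourced `H − s·O`, `s > 0` (response `m(s)`);
(2) every ceiling `ℓ` on the two-point quantity `Re Tr ρ(O†O)` valid over the same window obeys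
`min(m(s)², G·m(s)/s) ≤ ℓ` for the same sourced states — so no positivity-plus-energy-window relaxation, at
any level, certifies an order-parameter or long-range-order ceiling below the model's own sourced response at
the window's slack.

technique_class: energy-window observable relaxations as CEILINGS on an order parameter or on long-range order — reduced-density-matrix / moment / NPA / sum-of-squares semidefinite relaxations carrying positivity plus the certified window rows `E↓ ≤ ⟨H⟩ ≤ E↑` (any word set, level, footprint, symmetry reduction or solver), read as upper bounds on `Re ω(O)` or on `ω(A†A)` / structure factors / box functionals.
blocks: route steps of the shape "certify an order-parameter ceiling `M < min(m(s), G/s)` or a long-range-order ceiling `u < min(m(s)², G·m(s)/s)` at cap slack `G = E↑ − E₀` from positivity + energy-window rows alone", in particular an informative d-wave pair-LRO ceiling at `(U, δ) = (8, 1/8)` from any window whose cap slack exceeds the sourced-response scale [cite: WangEtAl2024, §II.D p. 9 and p. 16].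
because: the exact window set contains the mixtures `(1 − η)ρ̄₀ + ησ` of the symmetrised ground state with any state `σ`, at order `η·m` and energy `E₀ + η·D`, and a sourced ground state has `D ≤ s·m(s)` (`exists_isDensityMatrix_window`, `energyExcess_le_of_sourced`, `window_ceiling_ge_sourced`, `window_lro_ceiling_ge_sourced_self`); "the asymptotic value `o^(∞)` is only guaranteed to be equal to the actual ground-state value `o_GS` if `E↑ = E↓`" [cite: WangEtAl2024, §II.D p. 9]; window-only bounds carry "no convergence guarantees" [cite: FawziFawziScalet2024, §1].
evasions_known: (i) rows NOT satisfied by every low-energy state — ground-state stationarity `ω([H,X]) = 0` and ground-state positivity `ω(X†[H,X]) ≥ 0` [cite: FawziFawziScalet2024, §1] (`AraujoEtAl2023`): they remove the mixture whenever `Tr σ[H,X] ≠ 0` (`trace_mixture_mul_ne_zero`), and sourced ground states are not stationary for `H`; the residual floor is then set by STATIONARY (resp. locally stable) low-energy states only; (ii) shrinking the cap slack `G = E↑ − E₀` (better variational upper bounds); (iii) observables with small sourced response; (iv) floors on symmetry-even quantities and on odd one-point functions are a different entry (`OrderParameterInvisibleToGroundStateConstraints`).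
scope_caveats: finite dimension (the setting of every finite-volume certificate; torus-family node shapes are families of such inequalities, one per side `L`, with `G_L = u − E₀(L)/L²`); the floor is relative to the TRUE ground energy, not to a certified lower bound, and takes the response `m(s)` as input — the file proves the law, not a number; the converse secant bound (3) `Re Tr ρO ≤ (E₀ + G − E₀(H − sO))/s` is `window_ceiling_le_secant`; exact strong duality is not formalised.
status: established (theorem `EnergyWindowCeilingResolution_holds` below; printed statements [cite: WangEtAl2024, §II.D p. 9, p. 16] [cite: FawziFawziScalet2024, §1]).
[cite: WangEtAl2024, §II.D p. 9 and p. 16] -/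
def EnergyWindowCeilingResolution : Prop :=
  ∀ (n : Type) (_ : Fintype n) (_ : DecidableEq n) (H U O ρ₀ : Matrix n n ℂ) (G : ℝ),
    Uᴴ * U = 1 → H * U = U * H → Uᴴ * O * U = -O → IsGroundStateDensityMatrix H ρ₀ → 0 ≤ G →
    (∀ c : ℝ,
      (∀ ρ : Matrix n n ℂ, IsDensityMatrix ρ → (ρ * H).trace.re ≤ (ρ₀ * H).trace.re + G →
        (ρ * O).trace.re ≤ c) →
      (∀ σ : Matrix n n ℂ, IsDensityMatrix σ →
        min ((σ * O).trace.re) (G / ((σ * H).trace.re - (ρ₀ * H).trace.re) * (σ * O).trace.re) ≤ c) ∧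
      (∀ (s : ℝ) (σ : Matrix n n ℂ), 0 < s → IsGroundStateDensityMatrix (H - (s : ℂ) • O) σ →
        min ((σ * O).trace.re) (G / s) ≤ c)) ∧
    (∀ ℓ : ℝ,
      (∀ ρ : Matrix n n ℂ, IsDensityMatrix ρ → (ρ * H).trace.re ≤ (ρ₀ * H).trace.re + G →
        (ρ * (Oᴴ * O)).trace.re ≤ ℓ) →
      ∀ (s : ℝ) (σ : Matrix n n ℂ), 0 < s → IsGroundStateDensityMatrix (H - (s : ℂ) • O) σ →
        min ((σ * O).trace.re ^ 2) (G * (σ * O).trace.re / s) ≤ ℓ)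

/-- **The barrier holds** (PROVED; no named fact). [cite: WangEtAl2024, §II.D p. 9 and p. 16]
[cite: FawziFawziScalet2024, §1] [cite: KomaTasaki1994, §1] -/
theorem EnergyWindowCeilingResolution_holds : EnergyWindowCeilingResolution := by
  intro n _ _ H U O ρ₀ G hU hHU hOU hρ₀ hG
  refine ⟨fun c hc => ⟨fun σ hσ => window_ceiling_ge hU hHU hOU hρ₀ hσ hG hc,
    fun s σ hs hσ => window_ceiling_ge_sourced hU hHU hOU hρ₀ hs hσ hG hc⟩, fun ℓ hℓ s σ hs hσ => ?_⟩
  exact window_lro_ceiling_ge_sourced_self hU hHU hOU hρ₀ hs hσ hG hℓ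

/-! ### The sharpening: rows passed by both ends of the mixture segment do not lift the floor -/

section Rows

variable {n : Type*} [Fintype n] [DecidableEq n]

/-- **The mixture segment, explicitly.** For `η ∈ [0,1]` the state `ρ_η = mixture η (symmetrise U ρ₀) σ` is a
density matrix with energy `(1−η)E₀ + η·Re Tr σH` and order `η·Re Tr σO` (the witness of
`exists_isDensityMatrix_window`, named). [cite: WangEtAl2024, §II.D p. 9] -/
theorem mixture_symmetrise_window {H U O ρ₀ σ : Matrix n n ℂ} (hU : Uᴴ * U = 1) (hHU : H * U = U * H)
    (hOU : Uᴴ * O * U = -O) (hρ₀ : IsGroundStateDensityMatrix H ρ₀) (hσ : IsDensityMatrix σ) {η : ℝ}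
    (hη0 : 0 ≤ η) (hη1 : η ≤ 1) :
    IsDensityMatrix (mixture η (symmetrise U ρ₀) σ) ∧
      (mixture η (symmetrise U ρ₀) σ * H).trace.re = (1 - η) * (ρ₀ * H).trace.re + η * (σ * H).trace.re ∧
      (mixture η (symmetrise U ρ₀) σ * O).trace.re = η * (σ * O).trace.re := by
  have hρs := isGroundStateDensityMatrix_symmetrise hU hHU hρ₀
  refine ⟨isDensityMatrix_mixture hη0 hη1 hρs.1 hσ, ?_, ?_⟩
  · rw [re_trace_mixture_mul, trace_symmetrise_mul_eq hU hHU]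
  · rw [re_trace_mixture_mul, trace_symmetrise_mul_eq_zero hOU, Complex.zero_re, mul_zero, zero_add]

/-- **Clause (1) with extra rows (the sharpening of evasion (i)).** Let `R` be ANY family of additional
constraints (stationarity / equation-of-motion rows, ground-state positivity rows, imported windows, …) that
holds along the whole mixture segment `η ↦ (1−η)ρ̄₀ + ησ` — for LINEAR or convex rows this means: passed by the
symmetrised ground state AND by `σ` (`linearRows_mixture`). Then a ceiling `c` certified on the window CUT by
`R` still obeys `min(m, (G/D)·m) ≤ c`: rows that a low-energy state `σ` passes cannot push the ceiling below
`σ`'s diluted order — "the floor is set by the most-ordered state inside the window that passes the rows".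
[cite: WangEtAl2024, §II.D p. 9 and p. 16] [cite: FawziFawziScalet2024, §1] -/
theorem window_ceiling_ge_of_rows {H U O ρ₀ σ : Matrix n n ℂ} (hU : Uᴴ * U = 1) (hHU : H * U = U * H)
    (hOU : Uᴴ * O * U = -O) (hρ₀ : IsGroundStateDensityMatrix H ρ₀) (hσ : IsDensityMatrix σ) {G c : ℝ}
    (hG : 0 ≤ G) {R : Matrix n n ℂ → Prop}
    (hR : ∀ η : ℝ, 0 ≤ η → η ≤ 1 → R (mixture η (symmetrise U ρ₀) σ))
    (hc : ∀ ρ : Matrix n n ℂ, IsDensityMatrix ρ → R ρ → (ρ * H).trace.re ≤ (ρ₀ * H).trace.re + G →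
      (ρ * O).trace.re ≤ c) :
    min ((σ * O).trace.re) (G / ((σ * H).trace.re - (ρ₀ * H).trace.re) * (σ * O).trace.re) ≤ c := by
  set D : ℝ := (σ * H).trace.re - (ρ₀ * H).trace.re with hD
  set m : ℝ := (σ * O).trace.re with hm
  have hD0 : 0 ≤ D := by have := hρ₀.2 σ hσ; linarith
  -- the generic step: an admissible `η` gives `η·m ≤ c`
  have step : ∀ η : ℝ, 0 ≤ η → η ≤ 1 → η * D ≤ G → η * m ≤ c := by
    intro η hη0 hη1 hηD
    obtain ⟨hdens, hen, hord⟩ := mixture_symmetrise_window hU hHU hOU hρ₀ hσ hη0 hη1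
    have h := hc _ hdens (hR η hη0 hη1) (by rw [hen]; nlinarith)
    rwa [hord] at h
  by_cases hDG : D ≤ G
  · have h := step 1 zero_le_one le_rfl (by linarith)
    rw [one_mul] at h
    exact (min_le_left _ _).trans h
  · have hDG' : G < D := lt_of_not_ge hDG
    have hDpos : 0 < D := lt_of_le_of_lt hG hDG'
    have h := step (G / D) (div_nonneg hG hD0) ((div_le_one hDpos).mpr hDG'.le) (div_mul_cancel₀ G hDpos.ne').le
    exact (min_le_right _ _).trans h

omit [DecidableEq n] in
/-- **Linear rows are passed along the segment if passed at both ends**: equalities `Tr(ρX_i) = 0` and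
inequalities `0 ≤ Re Tr(ρY_j)` that hold for `ρ` and for `σ` hold for every mixture `(1−η)ρ + ησ`, `η ∈ [0,1]`
(so `window_ceiling_ge_of_rows` applies to any family of equation-of-motion and positivity rows passed by the
symmetrised ground state and by `σ`). [cite: FawziFawziScalet2024, §1] -/
theorem linearRows_mixture {ι κ : Type*} (X : ι → Matrix n n ℂ) (Y : κ → Matrix n n ℂ) {ρ σ : Matrix n n ℂ}
    (hρX : ∀ i, (ρ * X i).trace = 0) (hσX : ∀ i, (σ * X i).trace = 0)
    (hρY : ∀ j, 0 ≤ (ρ * Y j).trace.re) (hσY : ∀ j, 0 ≤ (σ * Y j).trace.re) {η : ℝ} (hη0 : 0 ≤ η) (hη1 : η ≤ 1) :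
    (∀ i, (mixture η ρ σ * X i).trace = 0) ∧ (∀ j, 0 ≤ (mixture η ρ σ * Y j).trace.re) := by
  refine ⟨fun i => ?_, fun j => ?_⟩
  · rw [trace_mixture_mul, hρX i, hσX i, mul_zero, mul_zero, add_zero]
  · rw [re_trace_mixture_mul]
    have h1 : 0 ≤ 1 - η := by linarith
    exact add_nonneg (mul_nonneg h1 (hρY j)) (mul_nonneg hη0 (hσY j))

end Rows

/-! ### §Cells (append, hubbard-obs-p1 g10, 2026-08-27): INTERVAL rows — what a μ-cell / slack-row family can buy

The cell's tier OP1-C (sr-mbsolver-menu-3 MENU3-TLPINCER §7; hubbard-obs PAIRCORR-SDP §16–§18) adds, on a cell of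
chemical potentials of half-width `Δ`, the INTERVAL rows `|Re Tr ρ[K, X_i]| ≤ b_i`, `b_i = Δ·|q_i|·B_i`, for charged
generators `X_i` (`K = H − μ′N` at the cell's grid point).  These rows are NOT passed by every low-energy state, so
clause (1) of the entry does not apply verbatim; but they are passed, with value `0`, by the symmetrised ground state,
and they are LINEAR — so the mixture `(1−η)ρ̄₀ + ησ` passes them for every `η ≤ η̄ := min_i b_i/|Re Tr σ[K,X_i]|`.
Consequently the sourced obstruction is only DILUTED by `η̄`, never removed (`window_ceiling_ge_of_intervalRows`);
for the sourced states `σ_s` (ground states of `H − s·O`, commuting with it) one has `Re Tr σ_s[H, X] = s·Re Tr σ_s[O, X]`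
(`re_trace_commutator_of_commute_sub_smul`), so interval rows of slack `b_i` let the certifier gain at most the factor
`η̄(s) = min_i b_i/(s·|Re Tr σ_s[O,X_i]|) ∧ 1` on the floor `min(m(s), G/s)` of clause (2)
(`window_ceiling_ge_sourced_of_intervalRows`) — LINEAR in the cell width.  Finite-dimensional, proved; the physics
reading (which `K`, which filling slice) is the cell's bookkeeping, not this file's. -/

section Cells

variable {n : Type*} [Fintype n] [DecidableEq n]

omit [DecidableEq n] in
/-- **Interval rows along the mixture segment.** If the base state passes the rows with value `0`
(`Re Tr(ρA_i) = 0`), then `Re Tr(ρ_η A_i) = η·Re Tr(σA_i)`, so every mixture with `0 ≤ η ≤ η̄` passes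
`|Re Tr(ρ_η A_i)| ≤ b_i` as soon as `η̄·|Re Tr(σA_i)| ≤ b_i`. [cite: FawziFawziScalet2024, §1] -/
theorem intervalRows_mixture {ι : Type*} (A : ι → Matrix n n ℂ) (b : ι → ℝ) {ρ σ : Matrix n n ℂ}
    (hρA : ∀ i, (ρ * A i).trace.re = 0) {ηbar : ℝ} (hbar : ∀ i, ηbar * |(σ * A i).trace.re| ≤ b i)
    {η : ℝ} (hη0 : 0 ≤ η) (hη : η ≤ ηbar) (i : ι) : |(mixture η ρ σ * A i).trace.re| ≤ b i := by
  rw [re_trace_mixture_mul, hρA i, mul_zero, zero_add, abs_mul, abs_of_nonneg hη0]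
  exact (mul_le_mul_of_nonneg_right hη (abs_nonneg _)).trans (hbar i)

/-- **Clause (1) for INTERVAL rows (μ-cells / slack rows): the obstruction is diluted by `η̄`, not removed.**
If `c` is a ceiling on `Re Tr ρO` over the density matrices of the window `Re Tr ρH ≤ E₀ + G` that ALSO pass the
interval rows `|Re Tr(ρA_i)| ≤ b_i`, the symmetrised ground state passes the rows with value `0`, and `σ` is ANY
density matrix (energy excess `D`, order `m`) with `η̄·|Re Tr(σA_i)| ≤ b_i` for some `η̄ ∈ [0,1]`, then
`min(η̄·m, (G/D)·m) ≤ c`. [cite: WangEtAl2024, §II.D p. 9 and p. 16] [cite: FawziFawziScalet2024, §1] -/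
theorem window_ceiling_ge_of_intervalRows {H U O ρ₀ σ : Matrix n n ℂ} (hU : Uᴴ * U = 1) (hHU : H * U = U * H)
    (hOU : Uᴴ * O * U = -O) (hρ₀ : IsGroundStateDensityMatrix H ρ₀) (hσ : IsDensityMatrix σ) {G c : ℝ}
    (hG : 0 ≤ G) {ι : Type*} (A : ι → Matrix n n ℂ) (b : ι → ℝ)
    (hA0 : ∀ i, (symmetrise U ρ₀ * A i).trace.re = 0) {ηbar : ℝ} (hbar0 : 0 ≤ ηbar) (hbar1 : ηbar ≤ 1)
    (hbar : ∀ i, ηbar * |(σ * A i).trace.re| ≤ b i)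
    (hc : ∀ ρ : Matrix n n ℂ, IsDensityMatrix ρ → (∀ i, |(ρ * A i).trace.re| ≤ b i) →
      (ρ * H).trace.re ≤ (ρ₀ * H).trace.re + G → (ρ * O).trace.re ≤ c) :
    min (ηbar * (σ * O).trace.re) (G / ((σ * H).trace.re - (ρ₀ * H).trace.re) * (σ * O).trace.re) ≤ c := by
  set D : ℝ := (σ * H).trace.re - (ρ₀ * H).trace.re with hD
  set m : ℝ := (σ * O).trace.re with hm
  have hD0 : 0 ≤ D := by have := hρ₀.2 σ hσ; linarith
  -- an admissible `η ≤ η̄` gives `η·m ≤ c`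
  have step : ∀ η : ℝ, 0 ≤ η → η ≤ ηbar → η * D ≤ G → η * m ≤ c := by
    intro η hη0 hηbar hηD
    obtain ⟨hdens, hen, hord⟩ := mixture_symmetrise_window hU hHU hOU hρ₀ hσ hη0 (hηbar.trans hbar1)
    have h := hc _ hdens (intervalRows_mixture A b hA0 hbar hη0 hηbar) (by rw [hen]; nlinarith)
    rwa [hord] at h
  have hc0 : 0 ≤ c := by
    have h := step 0 le_rfl hbar0 (by rw [zero_mul]; exact hG)
    rwa [zero_mul] at h
  by_cases hmle : m ≤ 0
  · -- nonpositive order: the second entry is `≤ 0 ≤ c`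
    have h2 : G / D * m ≤ 0 := mul_nonpos_of_nonneg_of_nonpos (div_nonneg hG hD0) hmle
    exact (min_le_right _ _).trans (h2.trans hc0)
  · by_cases hDG : ηbar * D ≤ G
    · exact (min_le_left _ _).trans (step ηbar hbar0 le_rfl hDG)
    · have hDG' : G < ηbar * D := lt_of_not_ge hDG
      have hDpos : 0 < D := by
        rcases hD0.lt_or_eq with h | h
        · exact h
        · exfalso; rw [← h, mul_zero] at hDG'; linarith
      have hη : G / D ≤ ηbar := by rw [div_le_iff₀ hDpos]; linarith
      have h := step (G / D) (div_nonneg hG hD0) hη (div_mul_cancel₀ G hDpos.ne').le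
      exact (min_le_right _ _).trans h

omit [DecidableEq n] in
/-- The trace of a state against a commutator with an operator it commutes with vanishes:
`σM = Mσ ⇒ Tr(σ(MX − XM)) = 0`. [cite: NielsenChuang2010, Thm 2.5 (§2.4.2)] -/
theorem trace_mul_commutator_eq_zero_of_commute {σ M X : Matrix n n ℂ} (h : σ * M = M * σ) :
    (σ * (M * X - X * M)).trace = 0 := by
  rw [Matrix.mul_sub, Matrix.trace_sub, ← Matrix.mul_assoc, h, Matrix.mul_assoc, Matrix.trace_mul_comm M (σ * X),
    Matrix.mul_assoc, sub_self]

omit [DecidableEq n] in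
/-- **Sourced states violate stationarity at order `s`.** If `σ` commutes with `M − s·O` (a ground-state projector of
the sourced operator does), then `Re Tr σ(MX − XM) = s·Re Tr σ(OX − XO)` — the typed form of the entry's remark
`Tr σ_s[H,X] = s·Tr σ_s[O,X]`. [cite: KomaTasaki1994, §1] -/
theorem re_trace_commutator_of_commute_sub_smul {σ M O X : Matrix n n ℂ} {s : ℝ}
    (h : σ * (M - (s : ℂ) • O) = (M - (s : ℂ) • O) * σ) :
    (σ * (M * X - X * M)).trace.re = s * (σ * (O * X - X * O)).trace.re := by
  have h0 := trace_mul_commutator_eq_zero_of_commute (X := X) h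
  have hsplit : σ * ((M - (s : ℂ) • O) * X - X * (M - (s : ℂ) • O)) =
      σ * (M * X - X * M) - (s : ℂ) • (σ * (O * X - X * O)) := by
    simp only [Matrix.sub_mul, Matrix.mul_sub, Matrix.smul_mul, Matrix.mul_smul, smul_sub]
    abel
  rw [hsplit, Matrix.trace_sub, Matrix.trace_smul, smul_eq_mul, sub_eq_zero] at h0
  rw [h0, Complex.re_ofReal_mul]

/-- The symmetrised state commutes with every `M` that commutes with `ρ₀` and with `U` (`U` unitary).
[cite: ScheerEtAl2025, p. 3, eq. (4)] -/
theorem symmetrise_mul_comm {U ρ₀ M : Matrix n n ℂ} (hU : Uᴴ * U = 1) (hρM : ρ₀ * M = M * ρ₀)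
    (hUM : U * M = M * U) : symmetrise U ρ₀ * M = M * symmetrise U ρ₀ := by
  have hUHM : Uᴴ * M = M * Uᴴ := by
    have h1 : Uᴴ * (U * M) * Uᴴ = Uᴴ * (M * U) * Uᴴ := by rw [hUM]
    have hUU : U * Uᴴ = 1 := mul_eq_one_comm.mp hU
    calc Uᴴ * M = Uᴴ * M * (U * Uᴴ) := by rw [hUU, Matrix.mul_one]
      _ = Uᴴ * (M * U) * Uᴴ := by simp only [Matrix.mul_assoc]
      _ = Uᴴ * (U * M) * Uᴴ := by rw [hUM]
      _ = (Uᴴ * U) * (M * Uᴴ) := by simp only [Matrix.mul_assoc]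
      _ = M * Uᴴ := by rw [hU, Matrix.one_mul]
  unfold symmetrise
  rw [Matrix.smul_mul, Matrix.mul_smul, Matrix.add_mul, Matrix.mul_add, hρM]
  congr 2
  calc U * ρ₀ * Uᴴ * M = U * ρ₀ * (Uᴴ * M) := by simp only [Matrix.mul_assoc]
    _ = U * ρ₀ * (M * Uᴴ) := by rw [hUHM]
    _ = U * (ρ₀ * M) * Uᴴ := by simp only [Matrix.mul_assoc]
    _ = U * (M * ρ₀) * Uᴴ := by rw [hρM]
    _ = (U * M) * ρ₀ * Uᴴ := by simp only [Matrix.mul_assoc]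
    _ = (M * U) * ρ₀ * Uᴴ := by rw [hUM]
    _ = M * (U * ρ₀ * Uᴴ) := by simp only [Matrix.mul_assoc]

/-- **Clause (2) for INTERVAL STATIONARITY rows (the OP1-C / μ-cell form): the sourced floor is diluted LINEARLY in the
slack.** Rows `|Re Tr ρ(MX_i − X_iM)| ≤ b_i` with `M` commuting with `ρ₀` and `U` (so the symmetrised ground state passes
them exactly); `σ` a ground-state density matrix of `H − s·O` (`s > 0`) commuting with `M − s·O`, response
`m(s) = Re Tr σO`, and `η̄ ∈ [0,1]` with `η̄·s·|Re Tr σ(OX_i − X_iO)| ≤ b_i` for all `i`. Then every ceiling `c` certified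
on the window `Re Tr ρH ≤ E₀ + G` cut by the rows obeys `min(η̄·m(s), G/s) ≤ c`: slack rows of size `b` weaken the
sourced obstruction `min(m(s), G/s)` of clause (2) by at most the factor `η̄ = min_i b_i/(s·|Re Tr σ[O,X_i]|)`.
[cite: WangEtAl2024, §II.D p. 9 and p. 16] [cite: KomaTasaki1994, §1] [cite: FawziFawziScalet2024, §1] -/
theorem window_ceiling_ge_sourced_of_intervalRows {H U O M ρ₀ σ : Matrix n n ℂ} (hU : Uᴴ * U = 1)
    (hHU : H * U = U * H) (hOU : Uᴴ * O * U = -O) (hρ₀ : IsGroundStateDensityMatrix H ρ₀)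
    (hρM : ρ₀ * M = M * ρ₀) (hUM : U * M = M * U) {s G c : ℝ} (hs : 0 < s)
    (hσ : IsGroundStateDensityMatrix (H - (s : ℂ) • O) σ) (hσM : σ * (M - (s : ℂ) • O) = (M - (s : ℂ) • O) * σ)
    (hG : 0 ≤ G) {ι : Type*} (X : ι → Matrix n n ℂ) (b : ι → ℝ) {ηbar : ℝ} (hbar0 : 0 ≤ ηbar) (hbar1 : ηbar ≤ 1)
    (hbar : ∀ i, ηbar * (s * |(σ * (O * X i - X i * O)).trace.re|) ≤ b i)
    (hc : ∀ ρ : Matrix n n ℂ, IsDensityMatrix ρ → (∀ i, |(ρ * (M * X i - X i * M)).trace.re| ≤ b i) →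
      (ρ * H).trace.re ≤ (ρ₀ * H).trace.re + G → (ρ * O).trace.re ≤ c) :
    min (ηbar * (σ * O).trace.re) (G / s) ≤ c := by
  set D : ℝ := (σ * H).trace.re - (ρ₀ * H).trace.re with hD
  set m : ℝ := (σ * O).trace.re with hm
  have hD0 : 0 ≤ D := by have := hρ₀.2 σ hσ.1; linarith
  have hDm : D ≤ s * m := energyExcess_le_of_sourced hU hHU hOU hρ₀ hσ
  -- the rows along the segment
  have hA0 : ∀ i, (symmetrise U ρ₀ * (M * X i - X i * M)).trace.re = 0 := fun i => by
    rw [trace_mul_commutator_eq_zero_of_commute (symmetrise_mul_comm hU hρM hUM), Complex.zero_re]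
  have hbar' : ∀ i, ηbar * |(σ * (M * X i - X i * M)).trace.re| ≤ b i := fun i => by
    rw [re_trace_commutator_of_commute_sub_smul hσM, abs_mul, abs_of_pos hs]
    exact hbar i
  -- an admissible `η ≤ η̄` gives `η·m ≤ c`
  have step : ∀ η : ℝ, 0 ≤ η → η ≤ ηbar → η * D ≤ G → η * m ≤ c := by
    intro η hη0 hηbar hηD
    obtain ⟨hdens, hen, hord⟩ := mixture_symmetrise_window hU hHU hOU hρ₀ hσ.1 hη0 (hηbar.trans hbar1)
    have h := hc _ hdens (intervalRows_mixture _ b hA0 hbar' hη0 hηbar) (by rw [hen]; nlinarith)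
    rwa [hord] at h
  have hc0 : 0 ≤ c := by
    have h := step 0 le_rfl hbar0 (by rw [zero_mul]; exact hG)
    rwa [zero_mul] at h
  by_cases hmle : m ≤ 0
  · have h1 : ηbar * m ≤ 0 := mul_nonpos_of_nonneg_of_nonpos hbar0 hmle
    exact (min_le_left _ _).trans (h1.trans hc0)
  · by_cases hDG : ηbar * D ≤ G
    · exact (min_le_left _ _).trans (step ηbar hbar0 le_rfl hDG)
    · have hDG' : G < ηbar * D := lt_of_not_ge hDG
      have hDpos : 0 < D := by
        rcases hD0.lt_or_eq with h | h
        · exact h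
        · exfalso; rw [← h, mul_zero] at hDG'; linarith
      have hη : G / D ≤ ηbar := by rw [div_le_iff₀ hDpos]; linarith
      have h2 := step (G / D) (div_nonneg hG hD0) hη (div_mul_cancel₀ G hDpos.ne').le
      -- `G/s ≤ (G/D)·m` because `D ≤ s·m`
      have hcmp : G / s ≤ G / D * m := by
        rw [div_mul_eq_mul_div, div_le_div_iff₀ hs hDpos]
        nlinarith [mul_le_mul_of_nonneg_left hDm hG]
      exact (min_le_right _ _).trans (hcmp.trans h2)

end Cells

end Literature.Barriers.HubbardSuperconductivity
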